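import Literature.AnabelianGeometry.SemiGraphs.CovObjOrbitCosetGraph
import Literature.AnabelianGeometry.SemiGraphs.SubgroupPresentationMap
import Literature.AnabelianGeometry.SemiGraphs.UniversalCoveringOverOneComponent
import Literature.AnabelianGeometry.SemiGraphs.TemperedPiDecomposition
import Literature.AnabelianGeometry.SemiGraphs.TemperedPiSystemSurj
import HarnessLib

/-!
# The subgroup presentation of `π₁^temp(𝒢)` from compatible point sequences ([SemiAnbd] Thm 3.7 (i)/(iii) pp. 40–41)

Mochizuki, *Semi-graphs of anabelioids*, Publ. RIMS **42** (2006), §3, proof of Thm. 3.7 (i) p. 40 (the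
verticial subgroups as decomposition groups of compatible points of the tower `𝒢_{∞,i}`) and of Thm.
3.7 (iii) p. 41 (the semi-graphs `𝒢_{∞,i}`) [cite: MochizukiSemiAnbd2006, Thm 3.7(iii) p.41].

DICTIONARY, part 3 (cell row T54-B, tower third, file T3c; plan/GAP-LEDGER.md G-w4d053-1), over
abc-iut-L3-t9's Galois tower (`GaloisLevelData`, `temperedPi = lim Gal(𝒢_{∞,n}/𝒢)`, `proj`), abc-iut-L3-t6's
compatible point sequences (`PointSeq`, `decompHom`) and part 1 (`CovObj.PtData.ptPresentation`): for
compatible point sequences `T w` over EVERY vertex and reference branches `R`, (i) the point data of every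
level `D.ptData T R n`, (ii) the levels' point presentations `D.levelPres T R n` inside `Gal(𝒢_{∞,n}/𝒢)`,
(iii) the PRESENTATION `D.piPresentation T R` of `𝔾` inside `π₁^temp(𝒢)` (`H_w := range (T w).decompHom`,
`M_e := Π_{β e}` through `(T (ν e)).decompHom`, branch elements the limits of the levels' `t_b⁻¹`, which are
`step`-compatible — `step_brAut`), and (iv) **`map_proj_piPresentation : (D.piPresentation T R).map
(D.proj n) = D.levelPres T R n`**.  With parts 1–2 and `cosetGraphMapIso` this identifies the trees
`𝒢_{∞,n}` with the coset semi-graphs `(D.piPresentation T R).cosetGraph (ker (D.proj n))`.  Nothing here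
bears on [IUTchIII] Cor. 3.12.
-/

namespace Literature.AnabelianGeometry.SemiGraphs

open CategoryTheory

universe u

/-! ### Reference branches of a semi-graph; extensionality of presentations -/

namespace SemiGraph

/-- **Reference branches**: for every edge `e` a chosen branch `β e` of `e` abutting to a vertex `ν e`
(exists for every edge of a connected semi-graph with a vertex). [cite: MochizukiSemiAnbd2006, §1 p.11] -/
structure RefBranches (𝔾 : SemiGraph.{u}) : Type u where
  /-- the reference branch of each edge -/
  β : 𝔾.Edge → 𝔾.Branch
  /-- it is a branch of the edge -/
  edgeOf_β : ∀ e, 𝔾.edgeOf (β e) = e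
  /-- the vertex it abuts to -/
  ν : 𝔾.Edge → 𝔾.Vertex
  /-- it abuts to `ν e` -/
  abuts_β : ∀ e, 𝔾.abuts (β e) = some (ν e)

/-- Extensionality of subgroup presentations. [cite: MochizukiSemiAnbd2006, §5 p.65] -/
theorem SubgroupPresentation.ext' {𝔾 : SemiGraph.{u}} {Γ : Type u} [Group Γ]
    {P Q : SubgroupPresentation 𝔾 Γ} (hH : P.H = Q.H) (hM : P.M = Q.M) (hs : P.s = Q.s) : P = Q := by
  cases P; cases Q
  cases hH; cases hM; cases hs
  rfl

end SemiGraph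

namespace ProfiniteSemiGraph

/-! ### Heterogeneous naturality of the gluings -/

variable {𝒢 : ProfiniteSemiGraph.{u}}

/-- Naturality of the inverse gluing under a morphism of coverings: `f (glue_b⁻¹ y) = glue_b⁻¹ (f y)`.
[cite: MochizukiSemiAnbd2006, Def 3.5(i) p.37] -/
theorem CovHom.fE_glue_inv' {T S : CovObj 𝒢} (f : T ⟶ S) (b : 𝒢.graph.Branch) (w : 𝒢.graph.Vertex)
    (hw : 𝒢.graph.abuts b = some w) (y : (T.SV w).obj.V) :
    (f.fE (𝒢.graph.edgeOf b)).hom.hom ((T.glue b w hw).inv.hom.hom y) =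
      (S.glue b w hw).inv.hom.hom ((f.fV w).hom.hom y) := by
  apply Function.LeftInverse.injective (S.glue_inv_hom b w hw)
  rw [CovHom.glue_fE, T.glue_hom_inv, S.glue_hom_inv]

/-- Naturality of `glueV` under a morphism of coverings (`Σ`-point form).
[cite: MochizukiSemiAnbd2006, Def 3.5(i) p.37] -/
theorem CovHom.fV_glueV' {T S : CovObj 𝒢} (f : T ⟶ S) (b : 𝒢.graph.Branch) (w : 𝒢.graph.Vertex)
    (hw : 𝒢.graph.abuts b = some w) (p : Σ e : 𝒢.graph.Edge, (T.SE e).obj.V) (hp : p.1 = 𝒢.graph.edgeOf b) :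
    (f.fV w).hom.hom (T.glueV b w hw p hp) = S.glueV b w hw ⟨p.1, (f.fE p.1).hom.hom p.2⟩ hp := by
  obtain ⟨e, z⟩ := p
  cases hp
  change (f.fV w).hom.hom ((T.glue b w hw).hom.hom.hom z) = (S.glue b w hw).hom.hom.hom ((f.fE _).hom.hom z)
  rw [CovHom.glue_fE]

namespace GaloisLevelData

open Literature.AlgebraicGeometry.Frobenioids.QuasiTemperoid.BTempConnected (ρ_one_apply
  ρ_mul_apply ρ_inv_apply ρ_apply_inv)

variable (D : GaloisLevelData 𝒢) (h𝒢 : 𝒢.IsCountable)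

/-! ### `Gal(𝒢_{∞,n}/𝒢)` as `Aut(𝒢_{∞,n})`: instance-transparent wrappers -/

/-- The projection `π₁^temp(𝒢) → Aut(𝒢_{∞,n})` (t9's `proj`, with the target written as `Aut`).
[cite: MochizukiSemiAnbd2006, Prop 3.6 p.38] -/
noncomputable def projAut (n : ℕ) : D.temperedPi h𝒢 →* Aut (D.cover h𝒢 n) := D.proj h𝒢 n

/-- `projAut` is `proj`. [cite: MochizukiSemiAnbd2006, Prop 3.6 p.38] -/
theorem projAut_apply (n : ℕ) (g : D.temperedPi h𝒢) : D.projAut h𝒢 n g = D.proj h𝒢 n g := rfl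

/-- `projAut` is surjective. [cite: MochizukiSemiAnbd2006, Prop 3.6 p.38] -/
theorem projAut_surjective (n : ℕ) : Function.Surjective (D.projAut h𝒢 n) := D.proj_surjective h𝒢 n

/-- The transition `Aut(𝒢_{∞,n+1}) → Aut(𝒢_{∞,n})` (t9's `step`, with source and target written as `Aut`).
[cite: MochizukiSemiAnbd2006, Prop 3.6 p.38] -/
noncomputable def stepAut (n : ℕ) : Aut (D.cover h𝒢 (n + 1)) →* Aut (D.cover h𝒢 n) := D.step h𝒢 n

/-- `stepAut` is `step`. [cite: MochizukiSemiAnbd2006, Prop 3.6 p.38] -/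
theorem stepAut_apply (n : ℕ) (σ : D.Gal h𝒢 (n + 1)) : D.stepAut h𝒢 n σ = D.step h𝒢 n σ := rfl

/-! ### The levels of the tower as coverings with point data -/

/-- `𝒢_{∞,n}` is connected as a covering. [cite: MochizukiSemiAnbd2006, Prop 3.6 p.38] -/
theorem cover_sameComponent (n : ℕ) (p q : (D.cover h𝒢 n).Point) : (D.cover h𝒢 n).SameComponent p q :=
  (D.S n).univCoverOver_sameComponent _ h𝒢 p q

/-- The endomorphisms of `𝒢_{∞,n}` act transitively on its vertex fibres. [cite: MochizukiSemiAnbd2006, Prop 3.6 p.38] -/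
theorem cover_htrans (n : ℕ) (v : 𝒢.graph.Vertex) (t t' : ((D.cover h𝒢 n).SV v).obj.V) :
    ∃ σ : D.cover h𝒢 n ⟶ D.cover h𝒢 n, (σ.fV v).hom.hom t = t' := by
  obtain ⟨η, hη⟩ := (D.S n).exists_aut_apply_eq' h𝒢 (D.W n) (D.htrans n) t t'
  exact ⟨η.hom, hη⟩

variable (T : ∀ w : 𝒢.graph.Vertex, D.PointSeq h𝒢 w) (R : SemiGraph.RefBranches 𝒢.graph)

/-- The point data of the level `𝒢_{∞,n}`: the `n`-th points of the sequences and the reference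
branches. [cite: MochizukiSemiAnbd2006, Thm 3.7(iii) p.41] -/
noncomputable def ptData (n : ℕ) : (D.cover h𝒢 n).PtData where
  x w := (T w).pt n
  β := R.β
  edgeOf_β := R.edgeOf_β
  ν := R.ν
  abuts_β := R.abuts_β

/-- **The point presentation of `𝔾` inside `G_n = Gal(𝒢_{∞,n}/𝒢)`** at level `n`.
[cite: MochizukiSemiAnbd2006, Thm 3.7(iii) p.41] -/
@[reducible] noncomputable def levelPres (n : ℕ) :
    SemiGraph.SubgroupPresentation 𝒢.graph (Aut (D.cover h𝒢 n)) :=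
  (D.ptData h𝒢 T R n).ptPresentation (D.cover_sameComponent h𝒢 n) (D.cover_htrans h𝒢 n)

/-- The base-point embedding of the level at `(T w).pt n` is `h ↦ σ_n^h` of the point sequence.
[cite: MochizukiSemiAnbd2006, Thm 3.7(i) p.40] -/
theorem ptHom_eq_gal (n : ℕ) (w : 𝒢.graph.Vertex) (h : 𝒢.Gv w) :
    (D.cover h𝒢 n).ptHom (D.cover_sameComponent h𝒢 n) (D.cover_htrans h𝒢 n) ((T w).pt n) h =
      (T w).gal n h :=
  (T w).eq_gal n h _ ((D.cover h𝒢 n).ptHom_apply _ _ _ h)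

/-- `proj n ∘ decompHom = ψ_{(T w).pt n}`, pointwise. [cite: MochizukiSemiAnbd2006, Thm 3.7(i) p.40] -/
theorem projAut_decompHom (n : ℕ) (w : 𝒢.graph.Vertex) (h : 𝒢.Gv w) :
    D.projAut h𝒢 n ((T w).decompHom h) =
      (D.cover h𝒢 n).ptHom (D.cover_sameComponent h𝒢 n) (D.cover_htrans h𝒢 n) ((T w).pt n) h :=
  ((T w).proj_decompHom n h).trans (D.ptHom_eq_gal h𝒢 T n w h).symm

/-- As homomorphisms into `Aut(𝒢_{∞,n})`. [cite: MochizukiSemiAnbd2006, Thm 3.7(i) p.40] -/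
theorem projAut_comp_decompHom (n : ℕ) (w : 𝒢.graph.Vertex) :
    (D.projAut h𝒢 n).comp (T w).decompHom =
      (D.cover h𝒢 n).ptHom (D.cover_sameComponent h𝒢 n) (D.cover_htrans h𝒢 n) ((T w).pt n) :=
  MonoidHom.ext fun h => D.projAut_decompHom h𝒢 T n w h

/-! ### The branch elements are compatible along the tower -/

/-- The covering maps of the tower carry the edge reference points to each other.
[cite: MochizukiSemiAnbd2006, Thm 3.7(iii) p.41] -/
theorem stepCover_ePt (n : ℕ) (e : 𝒢.graph.Edge) :
    ((D.stepCover h𝒢 n).fE _).hom.hom ((D.ptData h𝒢 T R (n + 1)).ePt e) = (D.ptData h𝒢 T R n).ePt e := by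
  change ((D.stepCover h𝒢 n).fE _).hom.hom
      (((D.cover h𝒢 (n + 1)).glue (R.β e) (R.ν e) (R.abuts_β e)).inv.hom.hom ((T (R.ν e)).pt (n + 1))) =
    ((D.cover h𝒢 n).glue (R.β e) (R.ν e) (R.abuts_β e)).inv.hom.hom ((T (R.ν e)).pt n)
  rw [CovHom.fE_glue_inv', (T (R.ν e)).compat n]

/-- The covering maps of the tower carry the pushed reference points to each other.
[cite: MochizukiSemiAnbd2006, Thm 3.7(iii) p.41] -/
theorem stepCover_brPt (n : ℕ) (b : 𝒢.graph.Branch) (w : 𝒢.graph.Vertex) (hw : 𝒢.graph.abuts b = some w) :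
    ((D.stepCover h𝒢 n).fV w).hom.hom ((D.ptData h𝒢 T R (n + 1)).brPt b w hw) =
      (D.ptData h𝒢 T R n).brPt b w hw := by
  unfold CovObj.PtData.brPt
  rw [CovHom.fV_glueV']
  dsimp only
  rw [D.stepCover_ePt h𝒢 T R n]
  rfl

/-- **The automorphisms `t_b^{(n)}` are `step`-compatible.** [cite: MochizukiSemiAnbd2006, Thm 3.7(iii) p.41] -/
theorem stepAut_brAut (n : ℕ) (b : 𝒢.graph.Branch) (w : 𝒢.graph.Vertex) (hw : 𝒢.graph.abuts b = some w) :
    D.stepAut h𝒢 n ((D.ptData h𝒢 T R (n + 1)).brAut (D.cover_sameComponent h𝒢 (n + 1))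
        (D.cover_htrans h𝒢 (n + 1)) b w hw) =
      (D.ptData h𝒢 T R n).brAut (D.cover_sameComponent h𝒢 n) (D.cover_htrans h𝒢 n) b w hw := by
  refine (D.cover h𝒢 n).aut_eq_of_fV_eq (D.cover_sameComponent h𝒢 n) ((T w).pt n) ?_
  have h1 := CovObj.PtData.brAut_apply (D.cover_sameComponent h𝒢 n) (D.cover_htrans h𝒢 n)
    (D.ptData h𝒢 T R n) b w hw
  have h2 := CovObj.PtData.brAut_apply (D.cover_sameComponent h𝒢 (n + 1)) (D.cover_htrans h𝒢 (n + 1))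
    (D.ptData h𝒢 T R (n + 1)) b w hw
  change ((CovObj.PtData.brAut _ _ (D.ptData h𝒢 T R (n + 1)) b w hw).hom.fV w).hom.hom ((T w).pt (n + 1)) =
    _ at h2
  refine (?_ : _ = (D.ptData h𝒢 T R n).brPt b w hw).trans h1.symm
  change ((D.step h𝒢 n _).hom.fV w).hom.hom ((T w).pt n) = _
  rw [← (T w).compat n, ← D.stepCover_apply_aut h𝒢 n, h2, D.stepCover_brPt h𝒢 T R n]

/-- **The branch elements of the levels are `step`-compatible.** [cite: MochizukiSemiAnbd2006, Thm 3.7(iii) p.41] -/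
theorem stepAut_brElt (n : ℕ) (b : 𝒢.graph.Branch) :
    D.stepAut h𝒢 n ((D.ptData h𝒢 T R (n + 1)).brElt (D.cover_sameComponent h𝒢 (n + 1))
        (D.cover_htrans h𝒢 (n + 1)) b) =
      (D.ptData h𝒢 T R n).brElt (D.cover_sameComponent h𝒢 n) (D.cover_htrans h𝒢 n) b := by
  rcases hb : 𝒢.graph.abuts b with _ | w
  · have h1 : ∀ (m : ℕ), (D.ptData h𝒢 T R m).brElt (D.cover_sameComponent h𝒢 m)
        (D.cover_htrans h𝒢 m) b = 1 := by
      intro m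
      unfold CovObj.PtData.brElt
      split
      · rename_i w' hw'
        exact absurd (hb.symm.trans hw') (by simp)
      · rfl
    rw [h1, h1]
    exact map_one (D.stepAut h𝒢 n)
  · rw [CovObj.PtData.brElt_of_abuts _ _ _ b w hb, CovObj.PtData.brElt_of_abuts _ _ _ b w hb,
      map_inv (D.stepAut h𝒢 n), D.stepAut_brAut h𝒢 T R n b w hb]

/-- The branch element `s_b ∈ π₁^temp(𝒢)`: the limit of the levels' branch elements.
[cite: MochizukiSemiAnbd2006, Thm 3.7(iii) p.41] -/
noncomputable def brEltPi (b : 𝒢.graph.Branch) : D.temperedPi h𝒢 :=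
  D.mkPi h𝒢 (fun n => (D.ptData h𝒢 T R n).brElt (D.cover_sameComponent h𝒢 n) (D.cover_htrans h𝒢 n) b)
    (fun n => D.stepAut_brElt h𝒢 T R n b)

/-- The projections of `s_b`. [cite: MochizukiSemiAnbd2006, Thm 3.7(iii) p.41] -/
theorem projAut_brEltPi (n : ℕ) (b : 𝒢.graph.Branch) :
    D.projAut h𝒢 n (D.brEltPi h𝒢 T R b) =
      (D.ptData h𝒢 T R n).brElt (D.cover_sameComponent h𝒢 n) (D.cover_htrans h𝒢 n) b := rfl

/-! ### The presentation of `𝔾` inside `π₁^temp(𝒢)` -/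

/-- **The subgroup presentation of `𝔾` inside `π₁^temp(𝒢)` attached to the point sequences `T` and the
reference branches `R`**: `H_w := range (T w).decompHom` (a verticial decomposition group, Thm. 3.7 (i)),
`M_e := (T (ν e)).decompHom (Π_{β e})`, `s_b :=` the limit of the levels' branch elements.
[cite: MochizukiSemiAnbd2006, Thm 3.7(i) p.40] -/
noncomputable def piPresentation : SemiGraph.SubgroupPresentation 𝒢.graph (D.temperedPi h𝒢) where
  H w := (T w).decompHom.range
  M e := (𝒢.branchSubgroup (R.β e) (R.ν e) (R.abuts_β e)).map (T (R.ν e)).decompHom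
  s b := D.brEltPi h𝒢 T R b
  conj_mem b w hw := by
    rintro _ ⟨k, ⟨g, hg⟩, rfl⟩
    obtain rfl : k = 𝒢.brHom _ _ _ g := hg.symm
    refine ⟨(𝒢.brHom b w hw (R.edgeOf_β (𝒢.graph.edgeOf b) ▸ g⁻¹))⁻¹, ?_⟩
    refine D.pi_ext h𝒢 fun n => ?_
    -- read the `n`-th components in `Aut(𝒢_{∞,n})`
    change D.projAut h𝒢 n _ = D.projAut h𝒢 n _
    simp only [map_mul, map_inv, D.projAut_decompHom h𝒢 T, D.projAut_brEltPi,
      (D.ptData h𝒢 T R n).brElt_of_abuts (D.cover_sameComponent h𝒢 n) (D.cover_htrans h𝒢 n) b w hw,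
      inv_inv]
    rw [← map_inv]
    exact (CovObj.PtData.brAut_conj_eq (D.cover_sameComponent h𝒢 n) (D.cover_htrans h𝒢 n)
      (D.ptData h𝒢 T R n) b w hw g).symm

/-- The vertex subgroups of the presentation. [cite: MochizukiSemiAnbd2006, Thm 3.7(i) p.40] -/
@[simp] theorem piPresentation_H (w : 𝒢.graph.Vertex) :
    (D.piPresentation h𝒢 T R).H w = (T w).decompHom.range := rfl

/-- The edge subgroups of the presentation. [cite: MochizukiSemiAnbd2006, Thm 3.7(i) p.40] -/
@[simp] theorem piPresentation_M (e : 𝒢.graph.Edge) :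
    (D.piPresentation h𝒢 T R).M e =
      (𝒢.branchSubgroup (R.β e) (R.ν e) (R.abuts_β e)).map (T (R.ν e)).decompHom := rfl

/-- The branch elements of the presentation. [cite: MochizukiSemiAnbd2006, Thm 3.7(i) p.40] -/
@[simp] theorem piPresentation_s (b : 𝒢.graph.Branch) :
    (D.piPresentation h𝒢 T R).s b = D.brEltPi h𝒢 T R b := rfl

/-- **The presentation of `π₁^temp(𝒢)` projects onto the point presentation of every level**:
`(D.piPresentation T R).map (D.projAut n) = D.levelPres T R n`. [cite: MochizukiSemiAnbd2006, Thm 3.7(iii) p.41] -/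
theorem map_projAut_piPresentation (n : ℕ) :
    (D.piPresentation h𝒢 T R).map (D.projAut h𝒢 n) = D.levelPres h𝒢 T R n := by
  refine SemiGraph.SubgroupPresentation.ext' (funext fun w => ?_) (funext fun e => ?_) (funext fun b => ?_)
  · change ((T w).decompHom.range).map (D.projAut h𝒢 n) = _
    rw [MonoidHom.map_range, D.projAut_comp_decompHom h𝒢 T]
    rfl
  · change ((𝒢.branchSubgroup (R.β e) (R.ν e) (R.abuts_β e)).map (T (R.ν e)).decompHom).map
        (D.projAut h𝒢 n) = _
    rw [Subgroup.map_map, D.projAut_comp_decompHom h𝒢 T]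
    rfl
  · exact D.projAut_brEltPi h𝒢 T R n b

end GaloisLevelData

end ProfiniteSemiGraph

end Literature.AnabelianGeometry.SemiGraphs
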